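import Mathlib

/-!
# Tier7/Line3/LocalHilbert90 — the (H90) input of Lemma WA′ at the non-split places, in the kernel

Filer: t7-L1-p3 (gen 4, prover-pub-hodge-repro2-t7-L1-p3-g4-0), TARGET line STATUS l. 15264. Lane: SUPPORT for
Line 3's version-(ii) chain (L3-ARGUMENT.md v13 §2f, the `a_γ₀ ≠ 0` row: Lemma WA′ — Tier7/Line3/DensityTransfer
p676334 `dense_of_approximations` takes, at every place `v ∈ T`, a continuous SURJECTION `q v : E v → N v` onto the
norm-one group (local Hilbert 90, Neukirch IV (3.5), lit-4 l. 15175)); NOT a line, NOT a device.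

WHAT IT SUPPLIES. At every place `v` — `E′_v = E′ ⊗_F F_v` a FIELD (the non-split finite places and the three
archimedean places) or `≅ F_v × F_v` (the split places) — the displayed input `(q v, hq v, hqs v)` of
`dense_of_approximations` is a theorem:

* (H1) `unitsMap_norm_unitsMap_aut` / `div_aut_mem_ker` — for any `K`-automorphism `g` of `L` and `y ∈ Lˣ`,
  `N_{L/K}(g y) = N_{L/K}(y)`, so `y / g y` lies in the NORM-ONE GROUP `(Units.map (Algebra.norm K)).ker ≤ Lˣ`
  (the group `E¹_v` of the memo, as a subgroup of `E′_v^×`).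
* (H2) `surjective_div_aut` — `L/K` finite cyclic Galois with generator `g`: `y ↦ y / g y` is SURJECTIVE from `Lˣ`
  onto the norm-one group. This is Hilbert's Theorem 90 (Mathlib's `groupCohomology.exists_div_of_norm_eq_one`,
  stated for fields in universe 0 — the local fields are).
* (H3) `continuous_aut` / `continuous_div_aut` / `continuous_div_aut_ker` — `K` a complete nontrivially normed field,
  `L` a T2 topological ring, finite-dimensional over `K` with continuous scalars (every finite extension of a local
  field with its unique topology): `g` is continuous (`LinearMap.continuous_of_finiteDimensional`), so `y ↦ y / g y`
  is continuous on `Lˣ` (`Units.continuous_iff`), and the map into the norm-one subgroup is continuous. With (H2):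
  `exists_continuous_surjective_div_aut` — a continuous surjection `Lˣ → (Units.map (Algebra.norm K)).ker`, which is
  exactly the displayed `(q v, hq v, hqs v)` at a non-split place.
* (H4) `div_conj_mem_ker` / `surjective_div_conj` / `continuous_div_conj` / `continuous_div_conj_ker` /
  `exists_continuous_surjective_div_conj` — the archimedean instance `ℂ / ℝ` by hand (`Algebra.norm ℝ = normSq`,
  `g = conj`; for `w` with `|w| = 1`, `w = exp(iθ) = z / z̄` with `z = exp(iθ/2)`), needing no Galois-theoretic
  instance on `ℂ`.
* (H5) `norm_prod_apply` / `surjective_div_swap` / `exists_continuous_surjective_div_swap` — the SPLIT places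
  `E′_v ≅ F_v × F_v` (`K × K` with the product algebra): the norm is `(x, y) ↦ x y`, the norm-one group is
  `{(a, a⁻¹)}`, and `u ↦ u / g u` for the swap automorphism `g` is a continuous surjection onto it
  (`(a, a⁻¹) = (a, 1) / (1, a)`; continuity from (H3), which is stated for any finite-dimensional T2 topological
  `K`-algebra). (H1) and (H3) are stated for rings, so they cover both the field and the split case.

NOT in this file: that `E′ ⊗_F F_v` is a field at the non-split `v`, quadratic hence cyclic Galois over `F_v`, with
the topology of the local field, and `≅ F_v × F_v` (with the swap as the conjugation) at the split `v` — the
dictionary; anything about `X`; nothing about the step (P) is claimed.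

§8(d) (uses an L-value-free non-vanishing device): NO — Hilbert 90 and continuity.
-/

namespace Summit.Ventures.HodgeRepro2.Tier7.Line3.LocalHilbert90

open Function

section Algebraic

variable {K L : Type} [CommRing K] [Ring L] [Algebra K L]

/-- (H1) The norm is invariant under `K`-automorphisms, on units: `N(g y) = N(y)`. -/
theorem unitsMap_norm_unitsMap_aut (g : L ≃ₐ[K] L) (y : Lˣ) :
    Units.map (Algebra.norm K : L →* K) (Units.map (g : L →* L) y) =
      Units.map (Algebra.norm K : L →* K) y := by
  ext
  simp [Algebra.norm_eq_of_algEquiv]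

/-- (H1) `y / g y` has norm one: it lies in the norm-one subgroup `(Units.map (Algebra.norm K)).ker` of
`Lˣ` (the group `E¹_v` as a subgroup of `E′_v^×`). -/
theorem div_aut_mem_ker (g : L ≃ₐ[K] L) (y : Lˣ) :
    y / Units.map (g : L →* L) y ∈ (Units.map (Algebra.norm K : L →* K)).ker := by
  rw [MonoidHom.mem_ker, map_div, unitsMap_norm_unitsMap_aut, div_self']

/-- The norm-one condition on a unit, read on the underlying field element. -/
theorem norm_eq_one_of_mem_ker {x : Lˣ} (hx : x ∈ (Units.map (Algebra.norm K : L →* K)).ker) :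
    Algebra.norm K (x : L) = 1 := by
  rw [MonoidHom.mem_ker] at hx
  have := congrArg Units.val hx
  simpa using this

end Algebraic

section Field

variable {K L : Type} [Field K] [Field L] [Algebra K L] [FiniteDimensional K L] [IsGalois K L]
  [IsCyclic (L ≃ₐ[K] L)]

/-- (H2) HILBERT 90 AS A SURJECTION. For `L/K` finite cyclic Galois with generator `g`, the map
`y ↦ y / g y : Lˣ → (Units.map (Algebra.norm K)).ker` is surjective: every norm-one element of `L` is
`y / g y` for some unit `y` (Mathlib's `groupCohomology.exists_div_of_norm_eq_one`). -/
theorem surjective_div_aut {g : L ≃ₐ[K] L} (hg : ∀ x, x ∈ Subgroup.zpowers g) :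
    Surjective (fun y : Lˣ => (⟨y / Units.map (g : L →* L) y, div_aut_mem_ker g y⟩ :
      (Units.map (Algebra.norm K : L →* K)).ker)) := by
  rintro ⟨x, hx⟩
  obtain ⟨y, hy⟩ := groupCohomology.exists_div_of_norm_eq_one hg (norm_eq_one_of_mem_ker hx)
  refine ⟨y, ?_⟩
  ext
  simpa using hy

end Field

section Topological

variable {K L : Type} [NontriviallyNormedField K] [CompleteSpace K] [Ring L] [Algebra K L]
  [TopologicalSpace L] [IsTopologicalRing L] [ContinuousSMul K L] [T2Space L]
  [FiniteDimensional K L]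

/-- (H3) A `K`-automorphism of a finite-dimensional `L` over a complete nontrivially normed `K` is
continuous (it is a `K`-linear map of a finite-dimensional space). -/
theorem continuous_aut (g : L ≃ₐ[K] L) : Continuous g :=
  (g.toLinearMap : L →ₗ[K] L).continuous_of_finiteDimensional

/-- (H3) `y ↦ y / g y` is continuous on the units (`Units.continuous_iff`: both `↑(y / g y) = y · g(y⁻¹)`
and `↑(y / g y)⁻¹ = g(y) · y⁻¹` are continuous). -/
theorem continuous_div_aut (g : L ≃ₐ[K] L) :
    Continuous (fun y : Lˣ => y / Units.map (g : L →* L) y) := by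
  rw [Units.continuous_iff]
  constructor
  · have : (Units.val ∘ fun y : Lˣ => y / Units.map (g : L →* L) y) =
        fun y : Lˣ => (y : L) * g (↑y⁻¹ : L) := by
      funext y
      simp [div_eq_mul_inv]
    rw [this]
    exact Units.continuous_val.mul ((continuous_aut g).comp Units.continuous_coe_inv)
  · have : (fun y : Lˣ => (↑(y / Units.map (g : L →* L) y)⁻¹ : L)) =
        fun y : Lˣ => g (y : L) * (↑y⁻¹ : L) := by
      funext y
      simp [div_eq_mul_inv]
    rw [this]
    exact ((continuous_aut g).comp Units.continuous_val).mul Units.continuous_coe_inv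

/-- (H3) The map into the norm-one subgroup is continuous. -/
theorem continuous_div_aut_ker (g : L ≃ₐ[K] L) :
    Continuous (fun y : Lˣ => (⟨y / Units.map (g : L →* L) y, div_aut_mem_ker g y⟩ :
      (Units.map (Algebra.norm K : L →* K)).ker)) :=
  (continuous_div_aut g).subtype_mk _

end Topological

section NonSplit

variable {K L : Type} [NontriviallyNormedField K] [CompleteSpace K] [Field L] [Algebra K L]
  [TopologicalSpace L] [IsTopologicalRing L] [ContinuousSMul K L] [T2Space L]
  [FiniteDimensional K L] [IsGalois K L] [IsCyclic (L ≃ₐ[K] L)]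

/-- (H2)+(H3) THE (H90) INPUT AT A NON-SPLIT PLACE: for `L/K` finite cyclic Galois (complete nontrivially
normed `K`, `L` a T2 topological ring with continuous `K`-scalars), there is a CONTINUOUS SURJECTION from
`Lˣ` onto the norm-one subgroup — the displayed `(q v, hq v, hqs v)` of
`DensityTransfer.dense_of_approximations`, with `q v = (y ↦ y / g y)`. -/
theorem exists_continuous_surjective_div_aut {g : L ≃ₐ[K] L} (hg : ∀ x, x ∈ Subgroup.zpowers g) :
    ∃ q : Lˣ → (Units.map (Algebra.norm K : L →* K)).ker,
      Continuous q ∧ Surjective q ∧ ∀ y, (q y : Lˣ) = y / Units.map (g : L →* L) y :=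
  ⟨fun y => ⟨y / Units.map (g : L →* L) y, div_aut_mem_ker g y⟩, continuous_div_aut_ker g,
    surjective_div_aut hg, fun _ => rfl⟩

end NonSplit

section Split

variable {K : Type} [Field K]

/-- (H5) The norm of the split algebra `K × K` over `K` is the product of the coordinates. -/
theorem norm_prod_apply (x y : K) : Algebra.norm K ((x, y) : K × K) = x * y := by
  rw [Algebra.norm_apply]
  have h : Algebra.lmul K (K × K) (x, y) =
      LinearMap.prodMap (x • LinearMap.id) (y • LinearMap.id) := by
    ext <;> simp
  rw [h, LinearMap.det_prodMap, LinearMap.det_smul, LinearMap.det_smul, LinearMap.det_id,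
    Module.finrank_self]
  simp

/-- (H5) HILBERT 90 AT A SPLIT PLACE, by hand: for the swap automorphism `g (x, y) = (y, x)` of
`K × K`, `u ↦ u / g u` is surjective from `(K × K)ˣ` onto the norm-one group `{(a, b) | a * b = 1}`
(`(a, a⁻¹) = (a, 1) / (1, a)`). -/
theorem surjective_div_swap (g : (K × K) ≃ₐ[K] (K × K)) (hg : ∀ p, g p = p.swap) :
    Surjective (fun u : (K × K)ˣ => (⟨u / Units.map (g : K × K →* K × K) u, div_aut_mem_ker g u⟩ :
      (Units.map (Algebra.norm K : K × K →* K)).ker)) := by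
  rintro ⟨x, hx⟩
  have hab : (x : K × K).1 * (x : K × K).2 = 1 := by
    rw [← norm_prod_apply]
    exact norm_eq_one_of_mem_ker hx
  have ha : (x : K × K).1 ≠ 0 := by
    intro h
    rw [h, zero_mul] at hab
    exact zero_ne_one hab
  refine ⟨MulEquiv.prodUnits.symm (Units.mk0 (x : K × K).1 ha, 1), ?_⟩
  ext1
  ext1
  rw [Units.val_div_eq_div_val]
  ext
  · simp [MulEquiv.prodUnits, hg]
  · simp [MulEquiv.prodUnits, hg]
    field_simp
    exact hab.symm

end Split

section SplitTopological

variable {K : Type} [NontriviallyNormedField K] [CompleteSpace K]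

/-- (H5) THE (H90) INPUT AT A SPLIT PLACE: a continuous surjection `(K × K)ˣ → {norm one}`,
`u ↦ u / g u` with `g` the swap (continuity from (H3): `K × K` is a finite-dimensional T2 topological
`K`-algebra). -/
theorem exists_continuous_surjective_div_swap (g : (K × K) ≃ₐ[K] (K × K))
    (hg : ∀ p, g p = p.swap) :
    ∃ q : (K × K)ˣ → (Units.map (Algebra.norm K : K × K →* K)).ker,
      Continuous q ∧ Surjective q ∧ ∀ u, (q u : (K × K)ˣ) = u / Units.map (g : K × K →* K × K) u :=
  ⟨fun u => ⟨u / Units.map (g : K × K →* K × K) u, div_aut_mem_ker g u⟩, continuous_div_aut_ker g,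
    surjective_div_swap g hg, fun _ => rfl⟩

end SplitTopological

section Archimedean

open Complex

/-- (H4) On `ℂ / ℝ`: `z / z̄` has norm one (`Algebra.norm ℝ = normSq`). -/
theorem div_conj_mem_ker (z : ℂˣ) :
    z / Units.map (Complex.conjAe : ℂ →* ℂ) z ∈ (Units.map (Algebra.norm ℝ : ℂ →* ℝ)).ker :=
  div_aut_mem_ker Complex.conjAe z

/-- (H4) For `w` of norm one, `w = exp (i θ)` with `θ = arg w`, and `z = exp (i θ / 2)` has `z / z̄ = w`. -/
theorem exists_div_conj_eq {w : ℂ} (hw : Complex.normSq w = 1) :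
    ∃ z : ℂ, z ≠ 0 ∧ z / (starRingEnd ℂ) z = w := by
  refine ⟨Complex.exp ((Complex.arg w / 2 : ℝ) * Complex.I), Complex.exp_ne_zero _, ?_⟩
  have hconj : (starRingEnd ℂ) (Complex.exp ((Complex.arg w / 2 : ℝ) * Complex.I)) =
      Complex.exp (-((Complex.arg w / 2 : ℝ) * Complex.I)) := by
    rw [← Complex.exp_conj]
    congr 1
    simp only [map_mul, Complex.conj_ofReal, Complex.conj_I, mul_neg]
  rw [hconj, ← Complex.exp_sub, sub_neg_eq_add, ← two_mul]
  have hnorm : ‖w‖ = 1 := by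
    have h1 : ‖w‖ ^ 2 = 1 := by rw [Complex.sq_norm, hw]
    have h0 : 0 ≤ ‖w‖ := norm_nonneg w
    nlinarith [sq_nonneg (‖w‖ - 1), sq_nonneg (‖w‖ + 1)]
  have hw' : Complex.exp (Complex.arg w * Complex.I) = w := by
    have := Complex.norm_mul_exp_arg_mul_I w
    rwa [hnorm, Complex.ofReal_one, one_mul] at this
  conv_rhs => rw [← hw']
  congr 1
  push_cast
  ring

/-- (H4) HILBERT 90 FOR `ℂ / ℝ`, by hand: `z ↦ z / z̄` is surjective from `ℂˣ` onto the norm-one group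
(the unit circle, as the kernel of `Units.map (Algebra.norm ℝ)`). -/
theorem surjective_div_conj :
    Surjective (fun z : ℂˣ => (⟨z / Units.map (Complex.conjAe : ℂ →* ℂ) z, div_conj_mem_ker z⟩ :
      (Units.map (Algebra.norm ℝ : ℂ →* ℝ)).ker)) := by
  rintro ⟨x, hx⟩
  have hx' : Complex.normSq (x : ℂ) = 1 := by
    rw [← Algebra.norm_complex_apply]
    exact norm_eq_one_of_mem_ker hx
  obtain ⟨z, hz, hzx⟩ := exists_div_conj_eq hx'
  refine ⟨Units.mk0 z hz, ?_⟩
  ext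
  simpa using hzx

/-- (H4) `z ↦ z / z̄` is continuous on `ℂˣ`. -/
theorem continuous_div_conj :
    Continuous (fun z : ℂˣ => z / Units.map (Complex.conjAe : ℂ →* ℂ) z) :=
  continuous_div_aut Complex.conjAe

/-- (H4) The map `ℂˣ → {norm one}` is continuous. -/
theorem continuous_div_conj_ker :
    Continuous (fun z : ℂˣ => (⟨z / Units.map (Complex.conjAe : ℂ →* ℂ) z, div_conj_mem_ker z⟩ :
      (Units.map (Algebra.norm ℝ : ℂ →* ℝ)).ker)) :=
  continuous_div_aut_ker Complex.conjAe

/-- (H4) THE (H90) INPUT AT AN ARCHIMEDEAN PLACE: a continuous surjection `ℂˣ → {norm one}`, `z ↦ z / z̄`. -/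
theorem exists_continuous_surjective_div_conj :
    ∃ q : ℂˣ → (Units.map (Algebra.norm ℝ : ℂ →* ℝ)).ker,
      Continuous q ∧ Surjective q ∧ ∀ z, (q z : ℂˣ) = z / Units.map (Complex.conjAe : ℂ →* ℂ) z :=
  ⟨fun z => ⟨z / Units.map (Complex.conjAe : ℂ →* ℂ) z, div_conj_mem_ker z⟩, continuous_div_conj_ker,
    surjective_div_conj, fun _ => rfl⟩

end Archimedean

end Summit.Ventures.HodgeRepro2.Tier7.Line3.LocalHilbert90
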